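import Summits.BirchSwinnertonDyer.BirchSwinnertonDyer.Theorems.UniversalToricDescentTwinTowerResidualCount
import HarnessLib

/-!
# Route UniversalToricDescent — the OBSTRUCTION INDEX `[P : Ψ(U) + T] ≤ #(Sel_𝔭^Σ/p·Sel_𝔭^Σ)` of the residual tuple
# signature from the strict-place surjectivity (S′) alone (first half of (M1) WITH INDEX)

Lead prover bsd-wall-utd-p1 g16 (`--supports` ♭T′ stmt-BirchSwinnertonDyer-26975; ONE-SIDED glue G≤ of skeleton v4a, line
`sigmacongruence`). g14's `natCard_selmerAc_pTorsion_eq_of_torsionIso_of_surj` (file `…TwinTowerResidualCount`) proves the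
EQUALITY `#Sel(E₁)[p] = #Sel(E₂)[p]` from two tower-level inputs for `E₂`: (S′) the strict-place surjectivity `hsurj₂` AND the
`p`-divisibility `hdiv₂` of `Sel_𝔭^Σ(K_∞, E₂[p^∞])`, the latter coming from «no non-zero finite `Λ`-submodule» (N′) — the input
that the ONE-SIDED crux ♭T≤ (pen pss3x g6, R1-♭T≤) is designed to avoid. This file removes `hdiv₂`:

* §0 `natCard_mul_natCard_quotient_sup` — `#T · #(P/(Ψ(U)+T)) = #(P/Ψ(U)) · #(Ψ(U) ∩ T)` (second and third isomorphism
  theorems; generalises `natCard_eq_natCard_quotient_mul_of_sup`, the case `Ψ(U) + T = P`).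
* §1 `natCard_quotient_range_sup_le` — **the obstruction map.** For the residual tuple signature `Ψ` on `U = H¹_ur(K_∞, E[p])`
  and `T = (ker ι_G)^{p^c}`: `[P : Ψ(U) + T] ≤ #(Sel_𝔭^Σ/p·Sel_𝔭^Σ)` as soon as every tuple of `H¹(H ∩ D_𝔭, E[p^∞])` is realised
  in `G_rel^Σ` (S′): `f ↦ p·s_f (mod p·Sel)` (`s_f ∈ G_rel^Σ` with signature `ι_G ∘ f`) is a well-defined homomorphism
  `P → Sel/p·Sel` whose kernel lies in `Ψ(U) + T` (Kummer lift, as in γb1).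
* (sequel file `…TwinTowerResidualCountIndex`: the two-curve count `#Sel(E₂)[p] ≤ #Sel(E₁)[p] · #(Sel(E₂)/p·Sel(E₂))`.)

HONEST STATUS: helper theorems, CONDITIONAL on the cited Poitou–Tate facts (first curve) and on the strict-place surjectivity
`hsurj₂` (stub TS1′ of skeleton v4a). THEOREMS ONLY; no definition, no named fact, no `sorry`. BSD is not advanced by this file.
References: [GreenbergVatsal2000] §2 Prop. (2.1), (2.8) (pp. 23–27); [GreenbergLNM1716] §4 Prop. 4.13 (pp. 122–124), §5 p. 114.
-/

set_option autoImplicit false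
-- `…BirchSwinnertonDyer.BirchSwinnertonDyer.Theorems…` is the problem's mandated namespace (D-0017).
set_option linter.dupNamespace false
noncomputable section
open scoped Classical
namespace Summit.BirchSwinnertonDyer.BirchSwinnertonDyer.Theorems.UniversalToricDescentStrictPlaceTuple

open CategoryTheory Function Field NumberField IsDedekindDomain WeierstrassCurve Literature.NumberTheory.GaloisRepresentations
  Literature.NumberTheory.EllipticCurves Literature.NumberTheory.EllipticCurves.GreenbergSelmer Literature.NumberTheory.GaloisCohomology
  Literature.NumberTheory.EllipticCurves.GreenbergVatsal2000 Summit.BirchSwinnertonDyer.Rank1Residual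
  Summit.BirchSwinnertonDyer.Rank1Residual.X11b Summit.BirchSwinnertonDyer.Rank1Residual.X11b.Coinv
  Summit.BirchSwinnertonDyer.Rank1Residual.X11b.LocBridge Summit.BirchSwinnertonDyer.Rank1Residual.X11b.AcSelmer
  Summit.BirchSwinnertonDyer.BirchSwinnertonDyer.Theorems.UniversalToricDescentSigmaLocalStabilizer
  Summit.BirchSwinnertonDyer.BirchSwinnertonDyer.Theorems.UniversalToricDescentSigmaLocalImage
  Summit.BirchSwinnertonDyer.BirchSwinnertonDyer.Theorems.UniversalToricDescentResidualSelmer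
  Summit.BirchSwinnertonDyer.BirchSwinnertonDyer.Theorems.UniversalToricDescentResidualSelmerExact
  Summit.BirchSwinnertonDyer.BirchSwinnertonDyer.Theorems.UniversalToricDescentLocalKummer
  Summit.BirchSwinnertonDyer.BirchSwinnertonDyer.Theorems.UniversalToricDescentSigmaCoinvariants

/-! ### §0 A counting lemma: `#T · #(P/(Ψ(U)+T)) = #(P/Ψ(U)) · #(Ψ(U) ∩ T)` -/

section Count
variable {U P : Type*} [AddCommGroup U] [AddCommGroup P]

/-- **`#T · #(P/(Ψ(U) + T)) = #(P/Ψ(U)) · #(Ψ(U) ∩ T)`** (`Nat.card`): the projection `π : T → P/Ψ(U)` has kernel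
`Ψ(U) ∩ T` and image `(Ψ(U) + T)/Ψ(U)`, and `(P/Ψ(U))/((Ψ(U)+T)/Ψ(U)) ≅ P/(Ψ(U)+T)`. [folklore] -/
theorem natCard_mul_natCard_quotient_sup (Ψ : U →+ P) (T : AddSubgroup P) :
    Nat.card T * Nat.card (P ⧸ (Ψ.range ⊔ T)) = Nat.card (P ⧸ Ψ.range) * Nat.card ((Ψ.range).addSubgroupOf T) := by
  let π : T →+ P ⧸ Ψ.range := (QuotientAddGroup.mk' Ψ.range).comp T.subtype
  have hker : π.ker = (Ψ.range).addSubgroupOf T := by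
    ext t
    rw [AddMonoidHom.mem_ker, AddSubgroup.mem_addSubgroupOf]
    change QuotientAddGroup.mk (t : P) = (0 : P ⧸ Ψ.range) ↔ _
    rw [QuotientAddGroup.eq_zero_iff]
  have hrange : π.range = (Ψ.range ⊔ T).map (QuotientAddGroup.mk' Ψ.range) := by
    rw [AddSubgroup.map_sup, QuotientAddGroup.map_mk'_self, bot_sup_eq, AddMonoidHom.range_comp, AddSubgroup.range_subtype]
  have hT : Nat.card T = Nat.card π.range * Nat.card π.ker := by
    rw [AddSubgroup.card_eq_card_quotient_mul_card_addSubgroup π.ker,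
      Nat.card_congr (QuotientAddGroup.quotientKerEquivRange π).toEquiv]
  have hP : Nat.card (P ⧸ Ψ.range) = Nat.card (P ⧸ (Ψ.range ⊔ T)) * Nat.card π.range := by
    rw [AddSubgroup.card_eq_card_quotient_mul_card_addSubgroup π.range, hrange,
      Nat.card_congr (QuotientAddGroup.quotientQuotientEquivQuotient Ψ.range (Ψ.range ⊔ T) le_sup_left).toEquiv]
  rw [hT, hP, hker]; ring

end Count

/-! ### §1 The obstruction map: `[P : Ψ(U) + T] ≤ #(Sel_𝔭^Σ / p·Sel_𝔭^Σ)` from the strict-place surjectivity -/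

section Obstruction
variable {K : Type} [Field K] [NumberField K] (W : WeierstrassCurve K) [W.IsElliptic] (p : ℕ)
  [Fact p.Prime] (κ : ZpExtension K p)

set_option maxHeartbeats 400000 in
/-- **The obstruction map.** `Ψ` the residual tuple signature on `U = H¹_ur(K_∞, E[p])` (any additive map with the formula
`hΨ`), `T = (ker ι_G)^{p^c}`, `Sel = Sel_𝔭^Σ(K_∞, E[p^∞])`. If every tuple of classes of `H¹(H ∩ D_𝔭, E[p^∞])` is realised in
`G_rel^Σ` (S′, `hsurj`), then `f ↦ p · s_f` (`s_f ∈ G_rel^Σ` realising `ι_G ∘ f`; `p s_f ∈ Sel`) is a well-defined homomorphism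
`θ : P → Sel/p·Sel` with `ker θ ≤ Ψ(U) + T` (if `p s_f = p s₁`, `s₁ ∈ Sel`, the Kummer lift `u` of `s_f − s₁` lies in `U` and
`f − Ψ u ∈ T`). Hence **`#(P/(Ψ(U)+T)) ≤ #(Sel/p·Sel)`** when the latter is finite.
[cite: GreenbergVatsal2000, §2 Prop. (2.8) (pp. 26–27)] [cite: GreenbergLNM1716, §4 Prop. 4.13 (pp. 122–124)] -/
theorem natCard_quotient_range_sup_le [IsTotallyComplex K]
    {𝔭 : HeightOneSpectrum (𝓞 K)}
    {γ : absoluteGaloisGroup K} (hγ : κ.IsTopGenerator γ) {S : Set (HeightOneSpectrum (𝓞 K))}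
    (hS : ∀ v : HeightOneSpectrum (𝓞 K), v ∉ S → ((p : ℕ) : 𝓞 K) ∉ v.asIdeal → W.HasGoodReductionAt v)
    {v₀ : HeightOneSpectrum (𝓞 K)} (hv₀ : ((p : ℕ) : 𝓞 K) ∉ v₀.asIdeal) (hv₀S : v₀ ∉ S) {c : ℕ}
    (hc : ∀ z : ℤ_[p], ∃ d : decomp (K := K) 𝔭, (κ (d : absoluteGaloisGroup K)).toAdd = (p : ℤ_[p]) ^ c * z)
    (hsurj : ∀ g : Fin (p ^ c) → subgroupH1 (kerD κ 𝔭) (W.geomPrimaryTorsion p),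
      ∃ s ∈ selmerAc W p κ v₀ S, ∀ i : Fin (p ^ c),
        resKerD κ (W.geomPrimaryTorsion p) 𝔭 (W.conjH1 p κ.kerSubgroup (γ ^ (i : ℕ)) s) = g i)
    (Ψ : unramifiedOutside κ.kerSubgroup (W.geomTorsion (p : ℤ)) p S →+
      (Fin (p ^ c) → Literature.NumberTheory.EllipticCurves.subgroupH1 (kerD κ 𝔭) (W.geomTorsion (p : ℤ))))
    (hΨ : ∀ (u : unramifiedOutside κ.kerSubgroup (W.geomTorsion (p : ℤ)) p S) (k : Fin (p ^ c)), Ψ u k =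
      resKerD κ (W.geomTorsion (p : ℤ)) 𝔭
        (Literature.NumberTheory.EllipticCurves.conjH1 κ.kerSubgroup (W.geomTorsion (p : ℤ)) (γ ^ (k : ℕ)) u))
    [Finite (↥(selmerAc W p κ 𝔭 S) ⧸ (nsmulAddMonoidHom (α := ↥(selmerAc W p κ 𝔭 S)) p).range)] :
    Nat.card ((Fin (p ^ c) → Literature.NumberTheory.EllipticCurves.subgroupH1 (kerD κ 𝔭) (W.geomTorsion (p : ℤ))) ⧸
        (Ψ.range ⊔ ((resH1Hom (ContinuousMonoidHom.id (kerD κ 𝔭))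
          (AddSubgroup.inclusion (geomTorsion_le_geomPrimaryTorsion W p)) (fun _ _ ↦ rfl) :
            Literature.NumberTheory.EllipticCurves.subgroupH1 (kerD κ 𝔭) (W.geomTorsion (p : ℤ)) →+
              subgroupH1 (kerD κ 𝔭) (W.geomPrimaryTorsion p)).compLeft (Fin (p ^ c))).ker)) ≤
      Nat.card (↥(selmerAc W p κ 𝔭 S) ⧸ (nsmulAddMonoidHom (α := ↥(selmerAc W p κ 𝔭 S)) p).range) := by
  set H := κ.kerSubgroup with hH
  set M := W.geomTorsion (p : ℤ) with hM
  set Sel := selmerAc W p κ 𝔭 S with hSel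
  set pSel : AddSubgroup ↥Sel := (nsmulAddMonoidHom (α := ↥Sel) p).range with hpSel
  set ιG : Literature.NumberTheory.EllipticCurves.subgroupH1 (kerD κ 𝔭) M →+
      subgroupH1 (kerD κ 𝔭) (W.geomPrimaryTorsion p) := resH1Hom (ContinuousMonoidHom.id (kerD κ 𝔭))
    (AddSubgroup.inclusion (geomTorsion_le_geomPrimaryTorsion W p)) (fun _ _ ↦ rfl) with hιG
  set T : AddSubgroup (Fin (p ^ c) → Literature.NumberTheory.EllipticCurves.subgroupH1 (kerD κ 𝔭) M) :=
    (ιG.compLeft (Fin (p ^ c))).ker with hTdef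
  have hT : ∀ f, f ∈ T ↔ ∀ k, ιG (f k) = 0 := fun f ↦ by
    rw [AddMonoidHom.mem_ker]; exact funext_iff
  -- the choice `f ↦ s_f ∈ G_rel^Σ` realising `ι_G ∘ f`, and `p s_f ∈ Sel`
  choose sf hsfD hsf using fun f : Fin (p ^ c) → Literature.NumberTheory.EllipticCurves.subgroupH1 (kerD κ 𝔭) M ↦
    hsurj (fun i ↦ ιG (f i))
  have hps : ∀ f, p • sf f ∈ Sel := by
    intro f
    rw [hSel, mem_selmerAc_iff_forall_fin_of_mem_relaxed W p κ hγ hc (AddSubgroup.nsmul_mem _ (hsfD f) p)]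
    intro i
    rw [map_nsmul, map_nsmul, hsf, ← map_nsmul, p_smul_subgroupH1_kerD_geomTorsion_eq_zero, map_zero]
  -- two classes of `G_rel^Σ` with the same signature differ by an element of `Sel`
  have hdiff : ∀ {s s' : W.subgroupH1 p H}, s ∈ selmerAc W p κ v₀ S → s' ∈ selmerAc W p κ v₀ S →
      (∀ i : Fin (p ^ c), resKerD κ (W.geomPrimaryTorsion p) 𝔭 (W.conjH1 p H (γ ^ (i : ℕ)) s) =
        resKerD κ (W.geomPrimaryTorsion p) 𝔭 (W.conjH1 p H (γ ^ (i : ℕ)) s')) → s - s' ∈ Sel := by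
    intro s s' hs hs' h
    rw [hSel, mem_selmerAc_iff_forall_fin_of_mem_relaxed W p κ hγ hc (sub_mem hs hs')]
    intro i
    rw [map_sub, map_sub, h i, sub_self]
  -- the obstruction map `θ : f ↦ p·s_f (mod p·Sel)` is additive
  let θ₀ : (Fin (p ^ c) → Literature.NumberTheory.EllipticCurves.subgroupH1 (kerD κ 𝔭) M) → ↥Sel ⧸ pSel :=
    fun f ↦ QuotientAddGroup.mk ⟨p • sf f, hps f⟩
  have hadd : ∀ f g, θ₀ (f + g) = θ₀ f + θ₀ g := by
    intro f g
    have hmem : sf (f + g) - (sf f + sf g) ∈ Sel := by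
      refine hdiff (hsfD _) (add_mem (hsfD f) (hsfD g)) fun i ↦ ?_
      rw [map_add, map_add, hsf, hsf, hsf, Pi.add_apply, map_add]
    change QuotientAddGroup.mk _ = QuotientAddGroup.mk _ + QuotientAddGroup.mk _
    rw [← QuotientAddGroup.mk_add, eq_comm, QuotientAddGroup.eq]
    refine ⟨⟨sf (f + g) - (sf f + sf g), hmem⟩, ?_⟩
    rw [nsmulAddMonoidHom_apply]
    apply Subtype.ext
    simp only [AddSubgroupClass.coe_nsmul, AddSubgroup.coe_add, AddSubgroup.coe_neg, smul_sub, smul_add, neg_add_rev]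
    abel
  let θ : (Fin (p ^ c) → Literature.NumberTheory.EllipticCurves.subgroupH1 (kerD κ 𝔭) M) →+ ↥Sel ⧸ pSel :=
    AddMonoidHom.mk' θ₀ hadd
  -- its kernel lies in `Ψ(U) + T`
  have hker : θ.ker ≤ Ψ.range ⊔ T := by
    intro f hf
    rw [AddMonoidHom.mem_ker] at hf
    change QuotientAddGroup.mk (⟨p • sf f, hps f⟩ : ↥Sel) = (0 : ↥Sel ⧸ pSel) at hf
    rw [QuotientAddGroup.eq_zero_iff, hpSel, AddMonoidHom.mem_range] at hf
    obtain ⟨s₁, hs₁⟩ := hf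
    rw [nsmulAddMonoidHom_apply] at hs₁
    have hps₁ : p • (s₁ : W.subgroupH1 p H) = p • sf f := by
      have := congrArg Subtype.val hs₁
      simpa using this
    -- Kummer lift of the `p`-torsion class `s_f − s₁`
    have htors : p • (sf f - (s₁ : W.subgroupH1 p H)) = 0 := by rw [smul_sub, hps₁, sub_self]
    obtain ⟨u, hu⟩ := W.exists_torsionToPrimaryH1Sub_eq p W.zsmul_geomPoints_surjective_holds htors
    have hs₁' : (s₁ : W.subgroupH1 p H) ∈ selmerAc W p κ v₀ S := selmerAc_le_relaxed W p κ 𝔭 hv₀ hv₀S s₁.2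
    have huU : u ∈ unramifiedOutside κ.kerSubgroup M p S := by
      rw [← comap_torsionToPrimaryH1Sub_relaxed_eq_unramifiedOutside W p κ hS hv₀ hv₀S, AddSubgroup.mem_comap, hu]
      exact sub_mem (hsfD f) hs₁'
    -- `f = Ψ u + (f − Ψ u)` with `f − Ψ u ∈ T`
    have hfT : f - Ψ ⟨u, huU⟩ ∈ T := by
      rw [hT]
      intro k
      have h0 : resKerD κ (W.geomPrimaryTorsion p) 𝔭 (W.conjH1 p H (γ ^ (k : ℕ)) (s₁ : W.subgroupH1 p H)) = 0 :=
        ((mem_selmerAc_iff_forall_fin_of_mem_relaxed W p κ hγ hc hs₁').mp s₁.2) k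
      rw [Pi.sub_apply, map_sub, hΨ, hιG, resKerD_iota_comm, ← WeierstrassCurve.conjH1_torsionToPrimaryH1Sub]
      change ιG (f k) - resKerD κ (W.geomPrimaryTorsion p) 𝔭 (W.conjH1 p H (γ ^ (k : ℕ))
        (W.torsionToPrimaryH1Sub p H u)) = 0
      rw [hu, map_sub, map_sub, hsf, h0, sub_zero, sub_self]
    have hsplit : f = Ψ ⟨u, huU⟩ + (f - Ψ ⟨u, huU⟩) := by abel
    rw [hsplit]
    exact AddSubgroup.add_mem_sup ⟨⟨u, huU⟩, rfl⟩ hfT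
  -- count: `P/(Ψ(U)+T)` is a quotient of `P/ker θ ≅ θ(P) ≤ Sel/p·Sel`
  haveI : Finite θ.range := inferInstance
  haveI hfk : Finite ((Fin (p ^ c) → Literature.NumberTheory.EllipticCurves.subgroupH1 (kerD κ 𝔭) M) ⧸ θ.ker) :=
    Finite.of_equiv _ (QuotientAddGroup.quotientKerEquivRange θ).toEquiv.symm
  calc Nat.card ((Fin (p ^ c) → Literature.NumberTheory.EllipticCurves.subgroupH1 (kerD κ 𝔭) M) ⧸ (Ψ.range ⊔ T))
      ≤ Nat.card ((Fin (p ^ c) → Literature.NumberTheory.EllipticCurves.subgroupH1 (kerD κ 𝔭) M) ⧸ θ.ker) :=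
        Nat.card_le_card_of_surjective _ (QuotientAddGroup.map_surjective_of_surjective θ.ker (Ψ.range ⊔ T)
          (AddMonoidHom.id _) QuotientAddGroup.mk_surjective (fun x hx ↦ hker hx))
    _ = Nat.card θ.range := Nat.card_congr (QuotientAddGroup.quotientKerEquivRange θ).toEquiv
    _ ≤ Nat.card (↥Sel ⧸ pSel) := Nat.card_le_card_of_injective _ θ.range.subtype_injective

end Obstruction

end Summit.BirchSwinnertonDyer.BirchSwinnertonDyer.Theorems.UniversalToricDescentStrictPlaceTuple

end
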